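import Mathlib.Topology.OpenPartialHomeomorph.Constructions
import Mathlib.Topology.OpenPartialHomeomorph.Composition
import Mathlib.Topology.Algebra.Group.Basic
import Mathlib.Topology.Algebra.ContinuousMonoidHom
import Mathlib.Algebra.Group.Subgroup.Basic
import HarnessLib

/-!
# Chart data for regular orbital integrals: TRANSPORT along an isomorphism of topological groups and PRODUCT with an abelian factor
# (N6ns-reg-(iv) CM dress — the generic plumbing between the field-level Cayley chart and `H_v = U(2)_v × U(1)_v`)

Topic `NumberTheory/Automorphic`; namespace `Literature.NumberTheory.Automorphic`. THEOREMS ONLY (no definition, no instance, no notation, no named fact, no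
`sorry`). Cell `pub/hodgecm-mathlib`, programme P3a, road «N6-ns», brick **N6ns-reg-(iv) CM DRESS** (LEAD F0P3a-plan (g9) T8-19 (D)(3)), the GENERIC half of FILE 2.

A CHART DATUM WITH BOX CLAUSE on a topological group `G` around `γ = τ b₀` (the shape delivered by ★ `UnitaryCayleyChartDatum.exists_unitary_cayleyChartDatum`
and read by ★ `OrbitalIntegralChartRealisation` ∕ ★ `Rogawski1990.LocalTransferChartJunction`): `e : OpenPartialHomeomorph (A × B) G` with `e = s·τ·s⁻¹` on its
source, `(a₀, b₀) ∈ e.source`, and inside every neighbourhood of `(a₀, b₀)` a compact-open box `K × B₁ ⊆ e.source` with (reg) `P (τ b) ∧ Z(τ b) = T`,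
(SAT) `x τ(b) x⁻¹ ∈ e(K × B₁) ⇒ x ∈ s(K)·T`, (SEP) `st (τ b) (τ b′) ⇒ b = b′`.

* §1 `exists_chartDatum_transport` — along `φ : G ≃ₜ* G′` the datum `(e, s, τ)` becomes `(φ ∘ e, φ ∘ s, φ ∘ τ)` with `T ↦ T.map φ`, `P ↦ P′` (any `P′` implied by
  `P` along `φ ∘ τ`), `st ↦ st′` (any `st′` implying `st` along `φ ∘ τ`); `centralizer_singleton_map_equiv`: `Z(φ t) = φ(Z(t))`.
* §2 `exists_chartDatum_prod` — for a second topological group `H₁` with COMMUTATIVE multiplication, a base point `u₀` with a compact-open neighbourhood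
  basis, an OPEN predicate `P` on `G × H₁` holding at `(τ b₀, u₀)`, and any `st` on `G × H₁` implying `st₂` on first components and EQUALITY on second
  components: the product datum `e(a, (b, u)) = (e₂(a, b), u)`, `s(a) = (s₂ a, 1)`, `τ(b, u) = (τ₂ b, u)` on `A × (B × H₁)` with `T ↦ T.prod ⊤`
  (`centralizer_singleton_prod_of_comm`: `Z((t, u)) = Z(t) × H₁`), boxes `K × (B₁ × C₁)`.
* §3 `exists_chartDatum_recoord` — re-coordinatisation of the torus factor along a homeomorphism `κ : B ≃ₜ B′` with `τ′ ∘ κ = τ` (boxes `K × κ(B₁)`);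
  `exists_homeomorph_centralizer_map` (`Z(γ) ≃ₜ Z(γ′)` along `φ : G ≃ₜ* G′`, `γ′ = φ γ`), `exists_homeomorph_centralizer_prod` (`Z(γ) × H₁ ≃ₜ Z((γ′, u))`) — the
  torus-coordinate forms `B := ↥(Subgroup.centralizer {·})` the (HLOC) junction reads (F0P2-p02 (g8) 02:40:25Z ∕ 02:43:45Z).

HONEST SCOPE. Point-set topology and group algebra only. HC_CM is proved only modulo the printed citations until rung 0 closes; this file discharges no
printed statement.

## References
* [HarishChandra1970] Harish-Chandra (notes by G. van Dijk), *Harmonic Analysis on Reductive p-adic Groups*, LNM 162 (1970), Part I §3 (local product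
  structure of regular orbits).
* [Rogawski1990] J. D. Rogawski, *Automorphic Representations of Unitary Groups in Three Variables*, Ann. of Math. Stud. 123 (1990), §3.1 p. 19
  (conjugacy classes of `H = U(2) × U(1)` are products), §4.3 p. 43.
* [BourbakiGT1] N. Bourbaki, *General Topology*, Ch. III §2 (topological groups: products, isomorphisms).
-/

set_option autoImplicit false

open Set Filter Topology
open scoped Pointwise

namespace Literature.NumberTheory.Automorphic

/-! ## §1 Transport along an isomorphism of topological groups -/

section Transport

variable {A B G G' : Type*} [TopologicalSpace A] [TopologicalSpace B]
  [Group G] [TopologicalSpace G] [Group G'] [TopologicalSpace G']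

omit [TopologicalSpace G] [TopologicalSpace G'] in
/-- `Z(φ t) = φ(Z(t))` for a group isomorphism `φ`. [cite: BourbakiGT1, Ch. III §2] -/
theorem centralizer_singleton_map_equiv (φ : G ≃* G') (t : G) :
    Subgroup.centralizer ({φ t} : Set G') = (Subgroup.centralizer ({t} : Set G)).map φ.toMonoidHom := by
  ext y
  rw [Subgroup.mem_map]
  constructor
  · intro hy
    rw [Subgroup.mem_centralizer_singleton_iff] at hy
    refine ⟨φ.symm y, ?_, φ.apply_symm_apply y⟩
    rw [Subgroup.mem_centralizer_singleton_iff]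
    apply φ.injective
    rw [map_mul, map_mul, φ.apply_symm_apply, hy]
  · rintro ⟨x, hx, rfl⟩
    rw [Subgroup.mem_centralizer_singleton_iff] at hx
    rw [Subgroup.mem_centralizer_singleton_iff]
    show φ x * φ t = φ t * φ x
    rw [← map_mul, hx, map_mul]

/-- **Transport of a chart datum with its box clause along `φ : G ≃ₜ* G′`.** The transported datum is `e′ = φ ∘ e` (same source), `s′ = φ ∘ s`,
`τ′ = φ ∘ τ`, the torus `T′ = φ(T)`; the regularity predicate and the separation relation may be replaced by any `P′` implied by `P`, resp. any `st′`
implying `st`, along `φ ∘ τ`. [cite: BourbakiGT1, Ch. III §2] [cite: HarishChandra1970, Part I §3] -/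
theorem exists_chartDatum_transport (φ : G ≃ₜ* G') (s : A → G) (τ : B → G)
    (e : OpenPartialHomeomorph (A × B) G) (he : ∀ p ∈ e.source, e p = s p.1 * τ p.2 * (s p.1)⁻¹)
    {a₀ : A} {b₀ : B} (T : Subgroup G) (P : G → Prop) (P' : G' → Prop) (hP : ∀ b, P (τ b) → P' (φ (τ b)))
    (st : G → G → Prop) (st' : G' → G' → Prop) (hst : ∀ b b', st' (φ (τ b)) (φ (τ b')) → st (τ b) (τ b'))
    (hbox : ∀ N ∈ 𝓝 (a₀, b₀), ∃ (K : Set A) (B₁ : Set B), IsCompact K ∧ IsOpen K ∧ a₀ ∈ K ∧ IsCompact B₁ ∧ IsOpen B₁ ∧ b₀ ∈ B₁ ∧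
      K ×ˢ B₁ ⊆ N ∧ K ×ˢ B₁ ⊆ e.source ∧
      (∀ b ∈ B₁, P (τ b) ∧ Subgroup.centralizer ({τ b} : Set G) = T) ∧
      (∀ b ∈ B₁, ∀ x : G, x * τ b * x⁻¹ ∈ e '' (K ×ˢ B₁) → x ∈ s '' K * (T : Set G)) ∧
      (∀ b ∈ B₁, ∀ b' ∈ B₁, st (τ b) (τ b') → b = b')) :
    ∃ e' : OpenPartialHomeomorph (A × B) G', e'.source = e.source ∧ (∀ p, e' p = φ (e p)) ∧
      (∀ p ∈ e'.source, e' p = φ (s p.1) * φ (τ p.2) * (φ (s p.1))⁻¹) ∧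
      ∀ N ∈ 𝓝 (a₀, b₀), ∃ (K : Set A) (B₁ : Set B), IsCompact K ∧ IsOpen K ∧ a₀ ∈ K ∧ IsCompact B₁ ∧ IsOpen B₁ ∧ b₀ ∈ B₁ ∧
        K ×ˢ B₁ ⊆ N ∧ K ×ˢ B₁ ⊆ e'.source ∧
        (∀ b ∈ B₁, P' (φ (τ b)) ∧ Subgroup.centralizer ({φ (τ b)} : Set G') = T.map φ.toMulEquiv.toMonoidHom) ∧
        (∀ b ∈ B₁, ∀ x : G', x * φ (τ b) * x⁻¹ ∈ e' '' (K ×ˢ B₁) →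
          x ∈ (fun a => φ (s a)) '' K * (T.map φ.toMulEquiv.toMonoidHom : Set G')) ∧
        (∀ b ∈ B₁, ∀ b' ∈ B₁, st' (φ (τ b)) (φ (τ b')) → b = b') := by
  refine ⟨e.transHomeomorph φ.toHomeomorph, rfl, fun p => rfl, ?_, ?_⟩
  · intro p hp
    show φ (e p) = _
    rw [he p hp, map_mul, map_mul, map_inv]
  · intro N hN
    obtain ⟨K, B₁, hKc, hKo, haK, hB₁c, hB₁o, hbB, hKBN, hKBs, hreg, hsat, hsep⟩ := hbox N hN
    refine ⟨K, B₁, hKc, hKo, haK, hB₁c, hB₁o, hbB, hKBN, hKBs, fun b hb => ⟨hP b (hreg b hb).1, ?_⟩, ?_, fun b hb b' hb' h => hsep b hb b' hb' (hst b b' h)⟩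
    · rw [← (hreg b hb).2]
      exact centralizer_singleton_map_equiv φ.toMulEquiv (τ b)
    · intro b hb x hx
      -- pull back along `φ`
      have hx' : φ.symm x * τ b * (φ.symm x)⁻¹ ∈ e '' (K ×ˢ B₁) := by
        obtain ⟨p, hp, hpx⟩ := hx
        refine ⟨p, hp, ?_⟩
        have hpx' : φ (e p) = x * φ (τ b) * x⁻¹ := hpx
        apply φ.injective
        rw [hpx', map_mul, map_mul, map_inv, φ.apply_symm_apply]
      obtain ⟨y, ⟨a, ha, rfl⟩, t, ht, hyt⟩ := Set.mem_mul.1 (hsat b hb (φ.symm x) hx')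
      refine Set.mem_mul.2 ⟨φ (s a), ⟨a, ha, rfl⟩, φ t, ⟨t, ht, rfl⟩, ?_⟩
      have h1 : φ (s a * t) = x := by rw [hyt, φ.apply_symm_apply]
      rw [← map_mul, h1]

end Transport

/-! ## §2 Product with an abelian factor -/

section Prod

variable {A B G H₁ : Type*} [TopologicalSpace A] [TopologicalSpace B]
  [Group G] [TopologicalSpace G] [Group H₁] [TopologicalSpace H₁]

omit [TopologicalSpace G] [TopologicalSpace H₁] in
/-- `Z((t, u)) = Z(t) × H₁` in `G × H₁` when `H₁` has commutative multiplication. [cite: Rogawski1990, §3.1 p. 19] -/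
theorem centralizer_singleton_prod_of_comm (hcomm : ∀ x y : H₁, x * y = y * x) (t : G) (u : H₁) :
    Subgroup.centralizer ({((t, u) : G × H₁)} : Set (G × H₁)) = (Subgroup.centralizer ({t} : Set G)).prod ⊤ := by
  ext x
  rw [Subgroup.mem_centralizer_singleton_iff, Subgroup.mem_prod, Subgroup.mem_centralizer_singleton_iff]
  simp only [Prod.ext_iff, Prod.fst_mul, Prod.snd_mul, Subgroup.mem_top, and_true]
  exact ⟨fun h => h.1, fun h => ⟨h, hcomm _ _⟩⟩

/-- **The product chart `e(a, (b, u)) = (e₂(a, b), u)`** as an open partial homeomorphism `A × (B × H₁) → G × H₁`, with source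
`{(a, (b, u)) | (a, b) ∈ e₂.source}` and forward map `(s₂ a, 1) · (τ₂ b, u) · (s₂ a, 1)⁻¹` on it. [cite: BourbakiGT1, Ch. III §2] -/
theorem exists_openPartialHomeomorph_prod_chart (e₂ : OpenPartialHomeomorph (A × B) G) (s₂ : A → G) (τ₂ : B → G)
    (he₂ : ∀ p ∈ e₂.source, e₂ p = s₂ p.1 * τ₂ p.2 * (s₂ p.1)⁻¹) :
    ∃ e : OpenPartialHomeomorph (A × (B × H₁)) (G × H₁),
      (∀ p, p ∈ e.source ↔ (p.1, p.2.1) ∈ e₂.source) ∧ (∀ p, e p = (e₂ (p.1, p.2.1), p.2.2)) ∧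
      ∀ p ∈ e.source, e p = ((s₂ p.1, (1 : H₁)) : G × H₁) * (τ₂ p.2.1, p.2.2) * ((s₂ p.1, (1 : H₁)) : G × H₁)⁻¹ := by
  refine ⟨(Homeomorph.prodAssoc A B H₁).symm.transOpenPartialHomeomorph (e₂.prod (OpenPartialHomeomorph.refl H₁)), ?_, fun p => rfl, ?_⟩
  · intro p
    rw [Homeomorph.transOpenPartialHomeomorph_source, OpenPartialHomeomorph.prod_source, OpenPartialHomeomorph.refl_source, Set.mem_preimage,
      Set.mem_prod]
    exact ⟨fun h => h.1, fun h => ⟨h, Set.mem_univ _⟩⟩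
  · intro p hp
    have hp2 : (p.1, p.2.1) ∈ e₂.source := by
      rw [Homeomorph.transOpenPartialHomeomorph_source, OpenPartialHomeomorph.prod_source, Set.mem_preimage, Set.mem_prod] at hp
      exact hp.1
    show (e₂ (p.1, p.2.1), p.2.2) = _
    rw [he₂ _ hp2, Prod.inv_mk, Prod.mk_mul_mk, Prod.mk_mul_mk, inv_one, one_mul, mul_one]

/-- **Product of a chart datum with an abelian factor.** Given a chart datum with box clause `(e₂, s₂, τ₂; P₂, T, st₂)` on `G` around `τ₂ b₀`, a second
topological group `H₁` with commutative multiplication and a compact-open neighbourhood basis at `u₀`, an OPEN predicate `P` on `G × H₁` holding at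
`(τ₂ b₀, u₀)`, and a relation `st` on `G × H₁` implying `st₂` on first and equality on second components along `τ`: the product datum
`(e, s, τ; P, T × H₁, st)` on `G × H₁` around `(τ₂ b₀, u₀)` with `s a = (s₂ a, 1)`, `τ(b, u) = (τ₂ b, u)`, boxes `K × (B₁ × C₁)`.
[cite: HarishChandra1970, Part I §3] [cite: Rogawski1990, §3.1 p. 19; §4.3 p. 43] -/
theorem exists_chartDatum_prod (hcomm : ∀ x y : H₁, x * y = y * x) (e₂ : OpenPartialHomeomorph (A × B) G)
    (s₂ : A → G) (hs₂ : Continuous s₂) (τ₂ : B → G) (hτ₂ : Continuous τ₂)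
    (he₂ : ∀ p ∈ e₂.source, e₂ p = s₂ p.1 * τ₂ p.2 * (s₂ p.1)⁻¹) {a₀ : A} {b₀ : B} (h₀ : (a₀, b₀) ∈ e₂.source)
    (T : Subgroup G) (P₂ : G → Prop) (st₂ : G → G → Prop)
    (hbox : ∀ N ∈ 𝓝 (a₀, b₀), ∃ (K : Set A) (B₁ : Set B), IsCompact K ∧ IsOpen K ∧ a₀ ∈ K ∧ IsCompact B₁ ∧ IsOpen B₁ ∧ b₀ ∈ B₁ ∧
      K ×ˢ B₁ ⊆ N ∧ K ×ˢ B₁ ⊆ e₂.source ∧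
      (∀ b ∈ B₁, P₂ (τ₂ b) ∧ Subgroup.centralizer ({τ₂ b} : Set G) = T) ∧
      (∀ b ∈ B₁, ∀ x : G, x * τ₂ b * x⁻¹ ∈ e₂ '' (K ×ˢ B₁) → x ∈ s₂ '' K * (T : Set G)) ∧
      (∀ b ∈ B₁, ∀ b' ∈ B₁, st₂ (τ₂ b) (τ₂ b') → b = b'))
    {u₀ : H₁} (hU : ∀ N ∈ 𝓝 u₀, ∃ C : Set H₁, IsCompact C ∧ IsOpen C ∧ u₀ ∈ C ∧ C ⊆ N)
    (P : G × H₁ → Prop) (hPo : IsOpen {x | P x}) (hP₀ : P (τ₂ b₀, u₀))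
    (st : G × H₁ → G × H₁ → Prop) (hst : ∀ x y : G × H₁, st x y → st₂ x.1 y.1 ∧ x.2 = y.2) :
    ∃ (s : A → G × H₁) (τ : B × H₁ → G × H₁) (e : OpenPartialHomeomorph (A × (B × H₁)) (G × H₁)),
      (∀ a, s a = (s₂ a, 1)) ∧ (∀ q, τ q = (τ₂ q.1, q.2)) ∧ Continuous s ∧ Continuous τ ∧
      (a₀, (b₀, u₀)) ∈ e.source ∧ (∀ p, e p = (e₂ (p.1, p.2.1), p.2.2)) ∧
      (∀ p ∈ e.source, e p = s p.1 * τ p.2 * (s p.1)⁻¹) ∧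
      ∀ N ∈ 𝓝 (a₀, (b₀, u₀)), ∃ (K : Set A) (B₁ : Set (B × H₁)), IsCompact K ∧ IsOpen K ∧ a₀ ∈ K ∧ IsCompact B₁ ∧ IsOpen B₁ ∧ (b₀, u₀) ∈ B₁ ∧
        K ×ˢ B₁ ⊆ N ∧ K ×ˢ B₁ ⊆ e.source ∧
        (∀ q ∈ B₁, P (τ q) ∧ Subgroup.centralizer ({τ q} : Set (G × H₁)) = T.prod ⊤) ∧
        (∀ q ∈ B₁, ∀ x : G × H₁, x * τ q * x⁻¹ ∈ e '' (K ×ˢ B₁) → x ∈ s '' K * ((T.prod ⊤ : Subgroup (G × H₁)) : Set (G × H₁))) ∧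
        (∀ q ∈ B₁, ∀ q' ∈ B₁, st (τ q) (τ q') → q = q') := by
  obtain ⟨e, hesrc, heval, he⟩ := exists_openPartialHomeomorph_prod_chart (H₁ := H₁) e₂ s₂ τ₂ he₂
  refine ⟨fun a => (s₂ a, 1), fun q => (τ₂ q.1, q.2), e, fun a => rfl, fun q => rfl, hs₂.prodMk continuous_const,
    (hτ₂.comp continuous_fst).prodMk continuous_snd, (hesrc _).2 h₀, heval, he, ?_⟩
  intro N hN
  -- the regular locus and the prescribed neighbourhood, cut into a triple product
  have hR : (fun p : A × (B × H₁) => ((τ₂ p.2.1, p.2.2) : G × H₁)) ⁻¹' {x | P x} ∈ 𝓝 (a₀, (b₀, u₀)) :=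
    (((hτ₂.comp continuous_fst).prodMk continuous_snd).comp continuous_snd).continuousAt.preimage_mem_nhds (hPo.mem_nhds hP₀)
  obtain ⟨NA, hNA, NBU, hNBU, hNN⟩ := mem_nhds_prod_iff.1 (inter_mem hN hR)
  obtain ⟨NB, hNB, NU, hNU, hNBU'⟩ := mem_nhds_prod_iff.1 hNBU
  obtain ⟨K, B₁, hKc, hKo, haK, hB₁c, hB₁o, hbB, hKBN, hKBs, hreg, hsat, hsep⟩ := hbox (NA ×ˢ NB) (prod_mem_nhds hNA hNB)
  obtain ⟨C, hCc, hCo, huC, hCN⟩ := hU NU hNU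
  have hsub : K ×ˢ (B₁ ×ˢ C) ⊆ N ∩ (fun p : A × (B × H₁) => ((τ₂ p.2.1, p.2.2) : G × H₁)) ⁻¹' {x | P x} := by
    intro p hp
    exact hNN (mk_mem_prod (hKBN (mk_mem_prod hp.1 hp.2.1)).1 (hNBU' (mk_mem_prod (hKBN (mk_mem_prod hp.1 hp.2.1)).2 (hCN hp.2.2))))
  refine ⟨K, B₁ ×ˢ C, hKc, hKo, haK, hB₁c.prod hCc, hB₁o.prod hCo, mk_mem_prod hbB huC, fun p hp => (hsub hp).1, ?_, ?_, ?_, ?_⟩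
  · intro p hp
    exact (hesrc p).2 (hKBs (mk_mem_prod hp.1 hp.2.1))
  · intro q hq
    refine ⟨?_, ?_⟩
    · exact (hsub (mk_mem_prod haK hq)).2
    · rw [centralizer_singleton_prod_of_comm hcomm, (hreg q.1 hq.1).2]
  · -- (SAT)
    rintro q hq ⟨x, y⟩ hx
    obtain ⟨p, hp, hpx⟩ := hx
    rw [heval] at hpx
    have hpx1 : e₂ (p.1, p.2.1) = x * τ₂ q.1 * x⁻¹ := by
      have h := congrArg Prod.fst hpx
      simpa only [Prod.fst_mul, Prod.fst_inv] using h
    have hx1 : x * τ₂ q.1 * x⁻¹ ∈ e₂ '' (K ×ˢ B₁) := ⟨(p.1, p.2.1), mk_mem_prod hp.1 hp.2.1, hpx1⟩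
    obtain ⟨z, ⟨a, ha, rfl⟩, t, ht, hzt⟩ := Set.mem_mul.1 (hsat q.1 hq.1 x hx1)
    refine Set.mem_mul.2 ⟨(s₂ a, 1), ⟨a, ha, rfl⟩, (t, y), ⟨ht, Subgroup.mem_top y⟩, ?_⟩
    rw [Prod.mk_mul_mk, one_mul, hzt]
  · -- (SEP)
    rintro ⟨b, u⟩ hq ⟨b', u'⟩ hq' h
    obtain ⟨h1, h2⟩ := hst _ _ h
    exact Prod.ext (hsep b hq.1 b' hq'.1 h1) h2

end Prod

/-! ## §3 Re-coordinatisation of the torus factor along a homeomorphism; centralisers along isomorphisms -/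

section Recoord

variable {A B B' G : Type*} [TopologicalSpace A] [TopologicalSpace B] [TopologicalSpace B'] [Group G] [TopologicalSpace G]

/-- **Re-coordinatisation of the torus factor.** If `κ : B ≃ₜ B′` and `τ′ ∘ κ = τ`, the chart datum `(e, s, τ)` with its box clause becomes the datum
`(e′, s, τ′)` on `A × B′` with `e′(a, b′) = e(a, κ⁻¹ b′)`, base point `(a₀, κ b₀)`, boxes `K × κ(B₁)`; `P`, `T`, `st` unchanged.
[cite: BourbakiGT1, Ch. III §2] [cite: HarishChandra1970, Part I §3] -/
theorem exists_chartDatum_recoord (κ : B ≃ₜ B') (s : A → G) (τ : B → G) (τ' : B' → G) (hττ' : ∀ b, τ' (κ b) = τ b)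
    (e : OpenPartialHomeomorph (A × B) G) (he : ∀ p ∈ e.source, e p = s p.1 * τ p.2 * (s p.1)⁻¹)
    {a₀ : A} {b₀ : B} (T : Subgroup G) (P : G → Prop) (st : G → G → Prop)
    (hbox : ∀ N ∈ 𝓝 (a₀, b₀), ∃ (K : Set A) (B₁ : Set B), IsCompact K ∧ IsOpen K ∧ a₀ ∈ K ∧ IsCompact B₁ ∧ IsOpen B₁ ∧ b₀ ∈ B₁ ∧
      K ×ˢ B₁ ⊆ N ∧ K ×ˢ B₁ ⊆ e.source ∧
      (∀ b ∈ B₁, P (τ b) ∧ Subgroup.centralizer ({τ b} : Set G) = T) ∧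
      (∀ b ∈ B₁, ∀ x : G, x * τ b * x⁻¹ ∈ e '' (K ×ˢ B₁) → x ∈ s '' K * (T : Set G)) ∧
      (∀ b ∈ B₁, ∀ b' ∈ B₁, st (τ b) (τ b') → b = b')) :
    ∃ e' : OpenPartialHomeomorph (A × B') G, (∀ p, p ∈ e'.source ↔ (p.1, κ.symm p.2) ∈ e.source) ∧
      (∀ p, e' p = e (p.1, κ.symm p.2)) ∧ (∀ p ∈ e'.source, e' p = s p.1 * τ' p.2 * (s p.1)⁻¹) ∧
      ∀ N ∈ 𝓝 (a₀, κ b₀), ∃ (K : Set A) (B₁ : Set B'), IsCompact K ∧ IsOpen K ∧ a₀ ∈ K ∧ IsCompact B₁ ∧ IsOpen B₁ ∧ κ b₀ ∈ B₁ ∧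
        K ×ˢ B₁ ⊆ N ∧ K ×ˢ B₁ ⊆ e'.source ∧
        (∀ b ∈ B₁, P (τ' b) ∧ Subgroup.centralizer ({τ' b} : Set G) = T) ∧
        (∀ b ∈ B₁, ∀ x : G, x * τ' b * x⁻¹ ∈ e' '' (K ×ˢ B₁) → x ∈ s '' K * (T : Set G)) ∧
        (∀ b ∈ B₁, ∀ b' ∈ B₁, st (τ' b) (τ' b') → b = b') := by
  have hτ'eq : ∀ b' : B', τ' b' = τ (κ.symm b') := fun b' => by rw [← hττ' (κ.symm b'), κ.apply_symm_apply]
  refine ⟨((Homeomorph.refl A).prodCongr κ.symm).transOpenPartialHomeomorph e, fun p => Iff.rfl, fun p => rfl, ?_, ?_⟩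
  · intro p hp
    have hp' : (p.1, κ.symm p.2) ∈ e.source := hp
    show e (p.1, κ.symm p.2) = _
    rw [he _ hp', hτ'eq]
  · intro N hN
    have hΘ : Continuous fun q : A × B => (q.1, κ q.2) := continuous_fst.prodMk (κ.continuous.comp continuous_snd)
    obtain ⟨K, B₁, hKc, hKo, haK, hB₁c, hB₁o, hbB, hKBN, hKBs, hreg, hsat, hsep⟩ := hbox _ (hΘ.continuousAt.preimage_mem_nhds hN)
    refine ⟨K, κ '' B₁, hKc, hKo, haK, hB₁c.image κ.continuous, κ.isOpenMap B₁ hB₁o, ⟨b₀, hbB, rfl⟩, ?_, ?_, ?_, ?_, ?_⟩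
    · rintro ⟨a, b'⟩ ⟨ha, ⟨b, hb, rfl⟩⟩
      exact hKBN (mk_mem_prod ha hb)
    · rintro ⟨a, b'⟩ ⟨ha, ⟨b, hb, rfl⟩⟩
      show (a, κ.symm (κ b)) ∈ e.source
      rw [κ.symm_apply_apply]
      exact hKBs (mk_mem_prod ha hb)
    · rintro b' ⟨b, hb, rfl⟩
      rw [hττ']
      exact hreg b hb
    · rintro b' ⟨b, hb, rfl⟩ x hx
      obtain ⟨⟨a, b''⟩, ⟨ha, ⟨b₂, hb₂, rfl⟩⟩, hpx⟩ := hx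
      have hpx' : e (a, b₂) = x * τ b * x⁻¹ := by
        rw [← hττ' b, ← hpx]
        show e (a, b₂) = e (a, κ.symm (κ b₂))
        rw [κ.symm_apply_apply]
      exact hsat b hb x ⟨(a, b₂), mk_mem_prod ha hb₂, hpx'⟩
    · rintro b' ⟨b, hb, rfl⟩ b'' ⟨b₂, hb₂, rfl⟩ h
      rw [hττ', hττ'] at h
      rw [hsep b hb b₂ hb₂ h]

variable {G' : Type*} [Group G'] [TopologicalSpace G']

omit [TopologicalSpace A] [TopologicalSpace B] [TopologicalSpace B'] in
/-- The centralisers of `γ` and of `γ′ = φ γ` are homeomorphic along `φ : G ≃ₜ* G′` (restriction of `φ`). [cite: BourbakiGT1, Ch. III §2] -/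
theorem exists_homeomorph_centralizer_map (φ : G ≃ₜ* G') (γ : G) (γ' : G') (hγ' : φ γ = γ') :
    ∃ κ : ↥(Subgroup.centralizer ({γ} : Set G)) ≃ₜ ↥(Subgroup.centralizer ({γ'} : Set G')), ∀ t, ((κ t : ↥(Subgroup.centralizer ({γ'} : Set G'))) : G') = φ t := by
  subst hγ'
  have hmem : ∀ t : G, t ∈ Subgroup.centralizer ({γ} : Set G) ↔ φ t ∈ Subgroup.centralizer ({φ γ} : Set G') := fun t => by
    rw [Subgroup.mem_centralizer_singleton_iff, Subgroup.mem_centralizer_singleton_iff, ← map_mul, ← map_mul]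
    exact ⟨fun h => by rw [h], fun h => φ.injective h⟩
  refine ⟨{ toFun := fun t => ⟨φ t, (hmem t).1 t.2⟩,
            invFun := fun t' => ⟨φ.symm t', (hmem _).2 (by rw [φ.apply_symm_apply]; exact t'.2)⟩,
            left_inv := fun t => Subtype.ext (φ.symm_apply_apply t),
            right_inv := fun t' => Subtype.ext (φ.apply_symm_apply t'),
            continuous_toFun := (φ.continuous.comp continuous_subtype_val).subtype_mk _,
            continuous_invFun := (φ.symm.continuous.comp continuous_subtype_val).subtype_mk _ }, fun t => rfl⟩

variable {H₁ : Type*} [Group H₁] [TopologicalSpace H₁]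

omit [TopologicalSpace A] [TopologicalSpace B] [TopologicalSpace B'] in
/-- For `φ : G ≃ₜ* G′`, `γ′ = φ γ` and `H₁` with commutative multiplication, `Z_G(γ) × H₁ ≃ₜ Z_{G′ × H₁}((γ′, u))`, `(t, u′) ↦ (φ t, u′)`.
[cite: BourbakiGT1, Ch. III §2] [cite: Rogawski1990, §3.1 p. 19] -/
theorem exists_homeomorph_centralizer_prod (hcomm : ∀ x y : H₁, x * y = y * x) (φ : G ≃ₜ* G') (γ : G) (γ' : G') (hγ' : φ γ = γ') (u : H₁) :
    ∃ κ : ↥(Subgroup.centralizer ({γ} : Set G)) × H₁ ≃ₜ ↥(Subgroup.centralizer ({((γ', u) : G' × H₁)} : Set (G' × H₁))),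
      ∀ q, ((κ q : ↥(Subgroup.centralizer ({((γ', u) : G' × H₁)} : Set (G' × H₁)))) : G' × H₁) = (φ q.1, q.2) := by
  subst hγ'
  have hmem : ∀ (t : G) (u' : H₁), t ∈ Subgroup.centralizer ({γ} : Set G) ↔
      ((φ t, u') : G' × H₁) ∈ Subgroup.centralizer ({((φ γ, u) : G' × H₁)} : Set (G' × H₁)) := fun t u' => by
    rw [centralizer_singleton_prod_of_comm hcomm, Subgroup.mem_prod, Subgroup.mem_centralizer_singleton_iff,
      Subgroup.mem_centralizer_singleton_iff, ← map_mul, ← map_mul]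
    simp only [Subgroup.mem_top, and_true]
    exact ⟨fun h => by rw [h], fun h => φ.injective h⟩
  refine ⟨{ toFun := fun q => ⟨(φ q.1, q.2), (hmem q.1 q.2).1 q.1.2⟩,
            invFun := fun z =>
              (⟨φ.symm (z : G' × H₁).1, (hmem _ (z : G' × H₁).2).2 (by rw [φ.apply_symm_apply]; exact z.2)⟩, (z : G' × H₁).2),
            left_inv := fun q => Prod.ext (Subtype.ext (φ.symm_apply_apply q.1)) rfl,
            right_inv := fun z => Subtype.ext (Prod.ext (φ.apply_symm_apply _) rfl),
            continuous_toFun := ((φ.continuous.comp (continuous_subtype_val.comp continuous_fst)).prodMk continuous_snd).subtype_mk _,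
            continuous_invFun := ((φ.symm.continuous.comp (continuous_fst.comp continuous_subtype_val)).subtype_mk _).prodMk
              (continuous_snd.comp continuous_subtype_val) }, fun q => rfl⟩

end Recoord

end Literature.NumberTheory.Automorphic
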